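import Summits.HubbardSuperconductivity.HubbardSuperconductivity.Theorems.AnisotropyChordTransferFibre3ManifoldA

/-!
# Route `AnisotropyChord` / H0 rotor rung: the MANIFOLD BAND — where the solution manifold sits in the `(θ, ν, a)` box (PartN41-A `ManifoldBand`, amended form)

Content of theory-1 g22's `ManifoldBand` (cycle22/lean/PartN41A.lean «FINAL» c1c48673ef9ec346, amended per p1's typing note:
`a(1 − 1/V) < 1` instead of `a < 1`, and the upper band in the form `a(V−1) ≤ V(1 − 4η gL⁻)`): for a ground profile with
`0 ≤ Δ < 1` at `L ≥ 128`, with `a = Δ f(x̂)`, `η = η_eff`, `ν = λ₂/θ²`, `V = L²`,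
`gL⁻ = ln L/2π + 0.0456 + 0.1266ν`, `gL⁺ = ln L/2π + 0.0510 + 0.234ν`:
★ `manifold_band`: `0 ≤ a`, `a(1 − 1/V) < 1`, `1 − 4η gL⁺ (1 + 1/V) ≤ a`, `a(V − 1) ≤ V(1 − 4η gL⁻)`
(manifold equation `4ηG̃(V+a) = V(1−a) + a` + `capacity_KT_bounds` + `nu_ceiling`).
Prover seat `hubbard-h0-rotor-p1` g26; helper for stmt-HubbardSuperconductivity-23918 (`--supports`, helper class).
WHAT THIS IS NOT: nothing here proves superconductivity in the Hubbard model; a family-A input of ONE conditional reduction.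
Tree imports only; no new definitions; no sorry, no axioms.
-/

set_option linter.dupNamespace false
set_option autoImplicit false

noncomputable section

open scoped BigOperators

namespace Summit.HubbardSuperconductivity.HubbardSuperconductivity.Theorems.AnisotropyChord.Transfer.Fibre3

namespace ManifoldA

variable (L : ℕ) [NeZero L]

/-- the elementary inequality behind the lower band: for `0 ≤ y ≤ 1`, `V ≥ 1`,
`(1 − y(1 + 1/V))(V − 1 + y) ≤ V(1 − y)`. [folklore] -/
theorem lower_band_ineq (y V : ℝ) (hy0 : 0 ≤ y) (hy1 : y ≤ 1) (hV : 1 ≤ V) :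
    (1 - y * (1 + 1 / V)) * (V - 1 + y) ≤ V * (1 - y) := by
  have hV0 : 0 < V := by linarith
  have hq : y * (1 - y) ≤ 1 / 4 := by nlinarith [sq_nonneg (2 * y - 1)]
  have hiV : 1 / V ≤ 1 := by rw [div_le_one hV0]; exact hV
  have hiV0 : 0 ≤ 1 / V := by positivity
  -- `V(1−y) − LHS = 1 − (1 + 1/V)·y(1−y) ≥ 0`
  have e : V * (1 - y) - (1 - y * (1 + 1 / V)) * (V - 1 + y) = 1 - (1 + 1 / V) * (y * (1 - y)) := by
    field_simp; ring
  nlinarith [mul_le_mul (show 1 + 1 / V ≤ 2 by linarith) hq (by nlinarith) (by norm_num)]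

/-- ★ MANIFOLD BAND (amended `ManifoldBand` content). [folklore] -/
theorem manifold_band (hL : 128 ≤ L) {Δ lam2 : ℝ} (hΔ0 : 0 ≤ Δ) (hΔ1 : Δ < 1) {f : Tor L → ℝ}
    (hf : IsGroundTwoMagnon L Δ lam2 f) :
    0 ≤ Δ * f (K1 L) ∧ Δ * f (K1 L) * (1 - 1 / (L : ℝ) ^ 2) < 1 ∧
    1 - 4 * etaEff L lam2 * (Real.log L / (2 * Real.pi) + 0.0510 + 0.234 * (lam2 / (2 * Real.pi / L) ^ 2))
        * (1 + 1 / (L : ℝ) ^ 2) ≤ Δ * f (K1 L) ∧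
    Δ * f (K1 L) * ((L : ℝ) ^ 2 - 1)
      ≤ (L : ℝ) ^ 2 * (1 - 4 * etaEff L lam2 * (Real.log L / (2 * Real.pi) + 0.0456 + 0.1266 * (lam2 / (2 * Real.pi / L) ^ 2))) := by
  have hπ := Real.pi_pos
  have hL5 : 5 ≤ L := by omega
  have hL0 : (0 : ℝ) < L := by exact_mod_cast (show 0 < L by omega)
  have hL128 : (128 : ℝ) ≤ L := by exact_mod_cast hL
  have hV : (0 : ℝ) < (L : ℝ) ^ 2 := by positivity
  have hV1 : (1 : ℝ) ≤ (L : ℝ) ^ 2 := by nlinarith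
  have hVbig : (16384 : ℝ) ≤ (L : ℝ) ^ 2 := by nlinarith
  obtain ⟨_, h2, _, _, h5, _, _⟩ := manifold_dictionary L hL5 hΔ0 hΔ1 hf
  have hME := manifold_equation L hL5 hΔ0 hΔ1 hf
  have hfpos : 0 < f (K1 L) := hf.1.2.2.1
  have hpos := lam2_pos L (by omega) hΔ1 hf.1
  have hη0 : 0 < etaEff L lam2 := by unfold etaEff; positivity
  -- the capacity bracket (`ν ≤ 0.07` by the ν-ceiling)
  have hθ2 : 0 < (2 * Real.pi / L) ^ 2 := by positivity
  set ν := lam2 / (2 * Real.pi / L) ^ 2 with hν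
  have hνlam : ν * (2 * Real.pi / L) ^ 2 = lam2 := by rw [hν]; field_simp
  have hν0 : 0 ≤ ν := by positivity
  have hν7 : ν ≤ 0.07 := by
    rw [hν, div_le_iff₀ hθ2]; linarith [nu_ceiling L hL hΔ0 hf]
  obtain ⟨hClo, hChi⟩ := CapacityConst.capacity_KT_bounds L (by omega) ν hν0 hν7
  rw [hνlam] at hClo hChi
  have hlog : 0 ≤ Real.log L / (2 * Real.pi) := by
    have : 0 ≤ Real.log L := Real.log_nonneg (by linarith)
    positivity
  set a := Δ * f (K1 L) with ha
  set η := etaEff L lam2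
  set G := Gres L lam2 0
  have hG0 : 0 < G := by linarith
  have ha0 : 0 ≤ a := mul_nonneg hΔ0 hfpos.le
  have hcS : 0 < cS L Δ lam2 f := by rw [h2]; positivity
  refine ⟨ha0, ?_, ?_, ?_⟩
  · -- `a(1 − 1/V) < 1` from `c_s G̃ = 1 − a + a/V > 0`
    have : 0 < cS L Δ lam2 f * G := mul_pos hcS hG0
    rw [h5] at this
    have e : a * (1 - 1 / (L : ℝ) ^ 2) = a - a / (L : ℝ) ^ 2 := by ring
    rw [e]; linarith
  · -- lower band
    set gp := Real.log L / (2 * Real.pi) + 0.0510 + 0.234 * ν with hgpdef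
    have hgp : G ≤ gp := by linarith
    set y := 4 * η * gp with hy
    have hgp0 : 0 ≤ gp := le_trans hG0.le hgp
    have hy0 : 0 ≤ y := by positivity
    rcases le_or_gt y 1 with hy1 | hy1
    · have h3 : (L : ℝ) ^ 2 * (1 - a) + a ≤ y * ((L : ℝ) ^ 2 + a) := by
        rw [← hME, hy]
        exact mul_le_mul_of_nonneg_right (mul_le_mul_of_nonneg_left hgp (by positivity)) (by positivity)
      have h4 : (L : ℝ) ^ 2 * (1 - y) ≤ a * ((L : ℝ) ^ 2 - 1 + y) := by linarith
      have key := lower_band_ineq y ((L : ℝ) ^ 2) hy0 hy1 hV1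
      have hD : 0 < (L : ℝ) ^ 2 - 1 + y := by linarith
      exact le_of_mul_le_mul_right (key.trans h4) hD
    · have : 0 ≤ y * (1 / (L : ℝ) ^ 2) := by positivity
      have : 1 - y * (1 + 1 / (L : ℝ) ^ 2) < 0 := by nlinarith
      linarith
  · -- upper band: `4η gm V ≤ 4η G (V + a) = V(1−a) + a`
    set gm := Real.log L / (2 * Real.pi) + 0.0456 + 0.1266 * ν with hgmdef
    have hgm : gm ≤ G := by linarith
    have e1 : 4 * η * gm * (L : ℝ) ^ 2 ≤ 4 * η * G * (L : ℝ) ^ 2 :=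
      mul_le_mul_of_nonneg_right (mul_le_mul_of_nonneg_left hgm (by positivity)) hV.le
    have e2 : 4 * η * G * (L : ℝ) ^ 2 ≤ 4 * η * G * ((L : ℝ) ^ 2 + a) :=
      mul_le_mul_of_nonneg_left (by linarith) (by positivity)
    have h3 : 4 * η * gm * (L : ℝ) ^ 2 ≤ (L : ℝ) ^ 2 * (1 - a) + a := by rw [← hME]; linarith
    linarith

end ManifoldA

end Summit.HubbardSuperconductivity.HubbardSuperconductivity.Theorems.AnisotropyChord.Transfer.Fibre3

end
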